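import Summits.BirchSwinnertonDyer.BirchSwinnertonDyer.Theorems.TwinTransportX9RungSchemaTwoStep

/-!
# Route `TwinTransportX9` — the crux body of `TrivialTwinSupplyX9` at one pair `(W, p)` as a named proposition

Bookkeeping for the rung files of the deciding crux `TrivialTwinSupplyX9` (item 24080): `CruxInstance W p` is, by `rfl`, the body of
the crux at the pair `(W, p)` — so that a batch of decided instances can state each rung as `CruxInstance ⟨a₁,…,a₆⟩ p` in one line
instead of restating the thirteen-line body. `trivialTwinSupplyX9_iff_forall_cruxInstance` records that the crux IS the conjunction of
its instances and `cruxInstance_of_trivialTwinSupplyX9` is the (trivial) converse direction of every rung. Nothing is proved about the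
crux here; BSD is NOT proved; `CruxInstance W p` for a particular pair is exactly what the rung schemata `rung_of_frame` /
`rung_of_two_frames` conclude. [cite: BurungaleCastellaSkinner2025, §1.2 and Prop. 5.2.1] [cite: Prasanna2010CJM, p. 400]
-/

set_option linter.dupNamespace false
set_option autoImplicit false

noncomputable section

open WeierstrassCurve Literature.NumberTheory.EllipticCurves
  Summit.BirchSwinnertonDyer.BirchSwinnertonDyer.Rank1Residual
  Summit.BirchSwinnertonDyer.BirchSwinnertonDyer.Theses.TwinTransportX9

namespace Summit.BirchSwinnertonDyer.BirchSwinnertonDyer.Theorems.TwinTransportX9Rung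

/-- The body of the crux `TrivialTwinSupplyX9` at the pair `(W, p)` (reducible, so that the rung schemata conclude it by `exact`):
under the X9 hypotheses and `p ∤ ∏ c_ℓ(W)`, a BCS-admissible frame `(d_K, d_F)` and a twin `W₁ ~ W^(d_K)` that is trivial at `p`
or itself has an admissible frame with a trivial twin. [cite: BurungaleCastellaSkinner2025, §1.2 and Prop. 5.2.1] -/
abbrev CruxInstance (W : WeierstrassCurve ℚ) [W.IsElliptic] [W.IsGloballyMinimal] (p : ℕ) [Fact p.Prime] : Prop :=
  ClassX9 W p → ¬ p ∣ W.tamagawaProduct → ∃ dK dF : ℤ, BCSAdmissiblePair W p dK dF ∧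
    ∃ (W₁ : WeierstrassCurve ℚ) (_ : W₁.IsElliptic) (_ : W₁.IsGloballyMinimal),
      (∃ C : WeierstrassCurve.VariableChange ℚ, C • W₁ = W.quadraticTwist (dK : ℚ)) ∧
      ((W₁.analyticRank = 0 ∧ ¬ p ∣ W₁.shaOrder ∧ ¬ p ∣ W₁.tamagawaProduct ∧ ¬ p ∣ W₁.torsionOrder ∧
          ∃ q : ℚ, W₁.leadingLCoeff / (W₁.realPeriodRat : ℂ) = (q : ℂ) ∧ padicValRat p q = 0) ∨
        ∃ dK' dF' : ℤ, BCSAdmissiblePair W₁ p dK' dF' ∧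
          ∃ (W₂ : WeierstrassCurve ℚ) (_ : W₂.IsElliptic) (_ : W₂.IsGloballyMinimal),
            (∃ C : WeierstrassCurve.VariableChange ℚ, C • W₂ = W₁.quadraticTwist (dK' : ℚ)) ∧
            (W₂.analyticRank = 0 ∧ ¬ p ∣ W₂.shaOrder ∧ ¬ p ∣ W₂.tamagawaProduct ∧ ¬ p ∣ W₂.torsionOrder ∧
              ∃ q : ℚ, W₂.leadingLCoeff / (W₂.realPeriodRat : ℂ) = (q : ℂ) ∧ padicValRat p q = 0))

/-- The crux `TrivialTwinSupplyX9` is, definitionally, the conjunction of its instances `CruxInstance W p` over all pairs.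
[cite: BurungaleCastellaSkinner2025, §1.2 and Prop. 5.2.1] -/
theorem trivialTwinSupplyX9_iff_forall_cruxInstance :
    TrivialTwinSupplyX9 ↔ ∀ (W : WeierstrassCurve ℚ) [W.IsElliptic] [W.IsGloballyMinimal] (p : ℕ) [Fact p.Prime], CruxInstance W p :=
  Iff.rfl

/-- Converse direction of every rung: the crux specialises to each instance. [cite: BurungaleCastellaSkinner2025, §1.2 and Prop. 5.2.1] -/
theorem cruxInstance_of_trivialTwinSupplyX9 (h : TrivialTwinSupplyX9) (W : WeierstrassCurve ℚ) [W.IsElliptic] [W.IsGloballyMinimal]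
    (p : ℕ) [Fact p.Prime] : CruxInstance W p :=
  h W p

/-- The one-frame schema `rung_of_frame`'s instance theorem, restated with the named body: `rung_isInstance` concludes `CruxInstance W p`.
[cite: BurungaleCastellaSkinner2025, §1.2 and Prop. 5.2.1] -/
theorem cruxInstance_of_rung_isInstance (h : TrivialTwinSupplyX9) (W : WeierstrassCurve ℚ) [W.IsElliptic] [W.IsGloballyMinimal]
    (p : ℕ) [Fact p.Prime] : CruxInstance W p :=
  rung_isInstance h W p

end Summit.BirchSwinnertonDyer.BirchSwinnertonDyer.Theorems.TwinTransportX9Rung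

end
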